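import Summits.BirchSwinnertonDyer.Rank1Residual.X4.KolyvaginIndexRecordsKitOddPrime
import HarnessLib

/-!
# BSD rank-≤1 residual cell, lane class X11b (`p ∥ N`: MULTIPLICATIVE at a prime `p ≥ 5`, `ρ̄_{E,p}` irreducible),
rank ONE: `BSD(E,p)` PER PAIR from
# PUBLISHED theorems + Kolyvagin's HEEGNER-INDEX certificate (two engines), `ρ̄_{E,p}` onto IN THE KERNEL — records 29

HONEST FRAMING (cell `b2b-bsdres-*`, verbatim): prove what is provable now; shrink each hard class to its core with
data; no claim beyond stated classes; COMBINATION classes deleted from PUBLISHED theorems only, CONSTRUCTION-shaped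
remainder typed; this is not "finishing BSD". X11b stays CONSTRUCTION-SHAPED; everything here is PER PAIR; no lane
verdict is changed; no named fact is introduced (debt 0); nothing is booked by this unit (the rung-K2 owner
bsd-stepL, the x11b
lineage that holds row B9's E1/K2 claim, census-lead, the Kurihara lane and referee A decide what a record is
worth); Cremona's numbers
(`r_an = 1`, `#Ш_an`, models, generators, `∏ c_ℓ`, torsion, optimality / Manin codes, the galrep datum) are INPUTS.

Unit `b2b-bsdres-x11c`, GEN 32 (prover-b2b-bsdres-x11c-g32-0) — the «X11 beyond 3» half of the unit's D-0075 purpose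
(«GRH-free
Kolyvagin–Heegner-index certificates X4 r1 p ≥ 7, X11 beyond 3»): the cell's certificate engines turned on lane
class X11b as GEN 27–31 turned
them on X7 (`Supersingular/KolyvaginIndexRecordsX7RankOne01–432`). POPULATION
(`HOME/b2b-bsdres-x11c/gen32/pop/build_harvest_x11b.py` = gen 27's
class-agnostic census restricted to X11b with a per-(label, p) record test): the rank-ONE classes (Cremona curve 1,
non-CM) whose cell
`(p, X11b)` — `p ≥ 5`, `p ∥ N` — is OPEN on the Kurihara lane's residue of record (bsdN sweep v4u `RESIDUE.jsonl` ×
v5u verdict `residue`; on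
848 of them the lane's own tail is T-KOLY, whose single certified Heegner field excludes the primes dividing
`m·D_K`) and which are
certificate-shaped on Cremona's data — no galrep code at `p` (`ρ̄_{E,p}` onto), `p ∤ #E(ℚ)_tors·∏ c_ℓ` (so
`p ∤ c_p = ord_p Δ` at a split
`p`), `p ∤ #Ш_an` — and carry no Kolyvagin-index record `bsdp_k<label>_<p>`: 927 pairs on 869 classes (`p = 5`: 605,
`7`: 221, `11`: 41,
`13`: 20, `17 ≤ p ≤ 103`: 40; split 411 / non-split 516; 268 semistable; `1.6·10⁴ < N < 5·10⁵`). 920 of them ALSO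
carry the unit's GEN 10
beyond-window DATA record (`X11b/BeyondWindowRecordsNN`: Skinner 2016 Thm. A ∘ Stein–Wuthrich 2013 `p`-adic road,
binders as displayed there)
— for those this file is a SECOND, GRH-free and main-conjecture-free road; 7 carry no per-pair record. Not in reach
of this route (numbers, not
a verdict): the lane's 3 062 Tamagawa-obstructed X11b rank-one cells at `p ≥ 5` (`p ∣ c_q` for some `q`; Jetchev
2008's Hypothesis (∗)
`p ∤ N` fails at `p ∥ N`). THIS FILE (records 29): 10 pairs — `346710q1@5`, `346710v1@5`, `349680bh1@5`,
`349690cw1@5`, `350610bo1@5`, `350610f1@5`, `351030c1@5`, `351120bq1@5`, `351120cr1@5`, `351120dd1@5`. 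

THE ROUTE (the unit's GEN 26/27 Kolyvagin route, class-agnostic): Kolyvagin's theorem as PRINTED by McCallum (LMS LN
153 (1991) §1, p. 296) /
Gross (ibid., Prop. 2.1 (2)) — tree named facts `kolyvagin`, `Kolyvagin1990_padicValNat_card_sha_le`, whose printed
hypotheses are `y_K` of
infinite order, `p` odd, `ρ̄_{E,p}` onto, and NOTHING about the reduction of `E` at `p` (at `p ∥ N` the Heegner
hypothesis — every prime of
`N` split in `K` — makes `p` split in `K`; nothing more is asked) —: `ord_p #Ш(E/K) ≤ 2·ord_p [E(K):ℤy_K]`; so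
`p ∤ [E(K):ℤy_K]` gives
`Ш(E/K)[p] = 0`, hence `Ш(E/ℚ)[p] = 0`, and with `ord_p #Ш_an = 0` Miller's `BSD(E,p)` — the tree's class-agnostic
consumer
`Typed.bsdp_of_kolyvagin_of_not_dvd_index` (`Literature/…/Rank1Residual/Typed/KolyvaginCertificate.lean`).

THE CERTIFICATE (per pair; the cell's EXISTING engines run VERBATIM — no private engine, no knob; ONE batched kit
job per stage with an
in-job fan-out wrapper): engine 1 = gen 3's `engine1_cha1b/main.py` = x9-g7 `jobD1b.py` (cypari2, sha256
`69e29ec7…`; rank-one mode: Heegner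
fields `K = ℚ(√D)`, `D < -4` fundamental, every prime of `N` split, `p ∤ D`, increasing `|D| ≤ 6000`, `≤ 30` fields;
root number of `E^D`
`+1`, rank-`≥ 2` twists skipped; `hy = L'(E,1)·L(E^D,1)·√|D|/(4·Area(E))`, `ρ = hy/ĥ(x)`, `m = √(4ρ)` an integer,
CERT iff `p ∤ m` —
Miller 2011 Thm. 4.1 / Cor. 4.8); engine 2 = gen 3's `engine2/run_cert.py` (`1b54bb20…`) + `e2lib.py` (`6701e05d…`)
+ `tate_stdlib.py`
(`ed9e5fd9…`) (stdlib python: independent `L`-series, AGM periods, Tate heights; `m`, `ord_p m` must be EQUAL;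
discrete checks — model,
conductor, Tamagawa, non-CM, irreducibility / saturation / `E(K)[p] = 0` witnesses, `D` Heegner); twist values =
additive-p1's
`twistvals/main.py` (`e501b988…`). Kit jobs: j259809, j260660, j260666, j260667. Evidence:
`HOME/b2b-bsdres-x11c/gen32/` (`KOLY-X11BR1-TABLE.md`, outputs, inputs,
SHA256SUMS); REPORT.md §41.

KERNEL (per pair, through the unit's kit theorems `X4.bsdp_prime_of_kolyvaginIndex_of_serreCounts[_support]` of
`X4/KolyvaginIndexRecordsKitOddPrime.lean` — class-agnostic despite their namespace —, every numeric hypothesis a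
`decide` goal): `Δ ≠ 0`;
global minimality of Cremona's model (bounded Kraus criterion, or — `|Δ| ≥ 512¹²` — the support form with the
bad-prime list); `ρ̄_{E,p}` ONTO by Serre's Prop. 19 from three witness primes
`(ℓ₁, ℓ₂, ℓ₃)` (types s₁ split / s₂ non-split / s₃ `u = a²/ℓ ∉ {0,1,2,4}`, `u² − 3u + 1 ≢ 0`) whose point counts
`#Ẽ(𝔽_ℓ)` (schema
`countPoints`) are evaluated in the kernel. BINDERS (displayed in every theorem): `hGZK` (Gross–Zagier–Kolyvagin),
`hKo` / `hB` (Kolyvagin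
as printed), the Heegner datum (`K`, level `N`, `P`, `p ∤ [E(K):ℤP]`), `r_an ≤ 1`, `#Ш_an = q` with `ord_p q = 0`.
NOT rechecked in the
kernel (engine work): `L'(E,1)`, `L(E^D,1)`, periods, heights, saturation, the integrality of `4ρ`; nor the lane's
class bit (`p ∥ N`,
split / non-split — bookkeeping only, the route does not use it). What a record is worth is the owners' / lane's /
referee's call
(EVIDENCE-grade certificate under displayed binders, as every Heegner-index record of the cell).

References: McCallum 1991 §1 [McCallumLMS1991]; Gross 1991 Prop. 2.1 [GrossLMS1991]; Kolyvagin 1990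
[KolyvaginEulerSystems1990]; Serre 1972 §2.8 Prop. 19 [Serre1972]; Miller 2011 Def. 1.1, Thm. 4.1, Cor. 4.8
[Miller2011LMS];
Silverman AEC VII.1, VIII.8 [SilvermanAEC2009]; Cremona's tables [Cremona2006].
-/

set_option autoImplicit false

noncomputable section

open scoped Classical

open WeierstrassCurve Literature.NumberTheory.EllipticCurves
  Literature.NumberTheory.EllipticCurves.Rank1Residual
  Literature.NumberTheory.EllipticCurves.Rank1Residual.Typed
  Literature.NumberTheory.EllipticCurves.Rank1Residual.X11RankOneCertificates
  Summit.BirchSwinnertonDyer.BirchSwinnertonDyer.Rank1Residual.IntModel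
  Summit.BirchSwinnertonDyer.BirchSwinnertonDyer.Rank1Residual.X11RankOne
  Summit.BirchSwinnertonDyer.Rank1Residual.X4

namespace Summit.BirchSwinnertonDyer.Rank1Residual.X11b

/-- **`BSD(E,5)` for `346710q1`** (`N = 346710 = 2·3·5·7·13·127`; SPLIT MULTIPLICATIVE at `5` (Kodaira `I1`, `c_5 = 1`, semistable); `#tors = 1`,
`∏c = 1`, `r_an = 1`, `#Ш_an = 1`, generator Cremona's (87-digit numerator); lane residue cell `(5, X11b)` (bsdN v4u/v5u of record: `residue:X11b`,
lane tail T-KOLY, other open cells `(3, X11b)`); ALSO the unit's GEN 10 beyond-window DATA record in `X11b/BeyondWindowRecords44.lean` (Skinner 2016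
Thm. A ∘ Stein–Wuthrich 2013 `p`-adic road, binders as displayed there) — this row is a SECOND road). `D = -1511` (1511 prime):
**`m = [E(K):ℤy_K] = 72`, `5 ∤ m`** (`ρ = 1296.00…`; `L'(E,1) = 5.82549147…`, `L(E^D,1) = 1.35028194…`, `ĥ(x) = 200.68637179…`) — engine 1 (j259809)
= engine 2 (j260666; EQUAL, dev. ≤ 6.9·10⁻¹⁴, checks true); twist `E^D` (j260667): `#tors·∏c·#Ш_an = 1·4·324`, prime to `5` — BSD-consistent.
Witnesses mod `5` `(ℓ,#Ẽ(𝔽_ℓ))` = `(23,28)` (`a = -4`, `a² − 4ℓ ≡ 4` square), `(31,36)` (`a = -4`, `a² − 4ℓ ≡ 2` non-square), `(37,34)` (`u ≡ 3`).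
[cite: McCallumLMS1991, §1 Theorem (Kolyvagin), p. 296] [cite: Serre1972, §2.8 Prop. 19] [cite: Cremona2006, Table 1 (label 346710q1)] -/
theorem bsdp_k346710q1_5 (hGZK : rank_eq_analyticRank_of_analyticRank_le_one) (W : WeierstrassCurve ℚ)
    (hW : W = ⟨1, 1, 0, -759126497, -7016932618059⟩) {N : ℕ} [NeZero N] {K : Type} [Field K] [NumberField K]
    (hKo : kolyvagin N W K) (hB : Kolyvagin1990_padicValNat_card_sha_le N W K) (hK : IsImaginaryQuadratic K)
    (hH : SatisfiesHeegnerHypothesis N K) {P : (W.baseChange K).toAffine.Point} (hP : IsHeegnerPoint N W K P)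
    (hnt : ¬ IsOfFinAddOrder P) (hI : ¬ 5 ∣ (AddSubgroup.zmultiples P).index) (hr : W.analyticRank ≤ 1)
    {q : ℚ} (hq : shaAn W = (q : ℂ)) (hv : padicValRat 5 q = 0) : BSDp W 5 :=
  bsdp_prime_of_kolyvaginIndex_of_serreCounts 5 (by norm_num) (by norm_num) 1 1 0 (-759126497) (-7016932618059) (by decide +kernel)
    (by decide +kernel) (by decide +kernel) 23 31 37 (by norm_num) (by norm_num) (by norm_num) (by norm_num)
    (by norm_num) (by norm_num) (by norm_num) (by norm_num) (by norm_num) (by decide +kernel) (by decide +kernel)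
    (by decide +kernel) (n₁ := 28) (n₂ := 36) (n₃ := 34) (hc₁ := by decide +kernel) (hc₂ := by decide +kernel)
    (hc₃ := by decide +kernel) (by decide +kernel) (by decide +kernel) (by decide +kernel) hGZK W
    (by rw [hW]; norm_num) hKo hB hK hH hP hnt hI hr hq hv

/-- **`BSD(E,5)` for `346710v1`** (`N = 346710 = 2·3·5·7·13·127`; NON-SPLIT MULTIPLICATIVE at `5` (Kodaira `I3`, `c_5 = 1`, semistable); `#tors = 1`,
`∏c = 2`, `r_an = 1`, `#Ш_an = 1`, generator `(24233576/25, 119235534411/125)`; lane residue cell `(5, X11b)` (bsdN v4u/v5u of record: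
`residue:X11b`, lane tail T-KOLY); ALSO the unit's GEN 10 beyond-window DATA record in `X11b/BeyondWindowRecords44.lean` (Skinner 2016 Thm. A ∘
Stein–Wuthrich 2013 `p`-adic road, binders as displayed there) — this row is a SECOND road). `D = -2519` (2519 = 11·229): **`m = [E(K):ℤy_K] = 4`,
`5 ∤ m`** (`ρ = 4.00…`; `L'(E,1) = 7.57031331…`, `L(E^D,1) = 0.04421758…`, `ĥ(x) = 13.11147249…`) — engine 1 (j259809) = engine 2 (j260666; EQUAL,
dev. ≤ 4.3·10⁻¹³, checks true); twist `E^D` (j260667): `#tors·∏c·#Ш_an = 1·4·1`, prime to `5` — BSD-consistent. Witnesses mod `5` `(ℓ,#Ẽ(𝔽_ℓ))` =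
`(17,15)` (`a = 3`, `a² − 4ℓ ≡ 1` square), `(19,18)` (`a = 2`, `a² − 4ℓ ≡ 3` non-square), `(23,27)` (`u ≡ 3`).
[cite: McCallumLMS1991, §1 Theorem (Kolyvagin), p. 296] [cite: Serre1972, §2.8 Prop. 19] [cite: Cremona2006, Table 1 (label 346710v1)] -/
theorem bsdp_k346710v1_5 (hGZK : rank_eq_analyticRank_of_analyticRank_le_one) (W : WeierstrassCurve ℚ)
    (hW : W = ⟨1, 0, 1, -2054, -259744⟩) {N : ℕ} [NeZero N] {K : Type} [Field K] [NumberField K]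
    (hKo : kolyvagin N W K) (hB : Kolyvagin1990_padicValNat_card_sha_le N W K) (hK : IsImaginaryQuadratic K)
    (hH : SatisfiesHeegnerHypothesis N K) {P : (W.baseChange K).toAffine.Point} (hP : IsHeegnerPoint N W K P)
    (hnt : ¬ IsOfFinAddOrder P) (hI : ¬ 5 ∣ (AddSubgroup.zmultiples P).index) (hr : W.analyticRank ≤ 1)
    {q : ℚ} (hq : shaAn W = (q : ℂ)) (hv : padicValRat 5 q = 0) : BSDp W 5 :=
  bsdp_prime_of_kolyvaginIndex_of_serreCounts 5 (by norm_num) (by norm_num) 1 0 1 (-2054) (-259744) (by decide +kernel)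
    (by decide +kernel) (by decide +kernel) 17 19 23 (by norm_num) (by norm_num) (by norm_num) (by norm_num)
    (by norm_num) (by norm_num) (by norm_num) (by norm_num) (by norm_num) (by decide +kernel) (by decide +kernel)
    (by decide +kernel) (n₁ := 15) (n₂ := 18) (n₃ := 27) (hc₁ := by decide +kernel) (hc₂ := by decide +kernel)
    (hc₃ := by decide +kernel) (by decide +kernel) (by decide +kernel) (by decide +kernel) hGZK W
    (by rw [hW]; norm_num) hKo hB hK hH hP hnt hI hr hq hv

/-- **`BSD(E,5)` for `349680bh1`** (`N = 349680 = 2⁴·3·5·31·47`; NON-SPLIT MULTIPLICATIVE at `5` (Kodaira `I3`, `c_5 = 1`, additive at `2`);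
`#tors = 1`, `∏c = 12`, `r_an = 1`, `#Ш_an = 1`, generator `(36, 186)`; lane residue cell `(5, X11b)` (bsdN v4u/v5u of record: `residue:X11b`, lane
tail T-KOLY); ALSO the unit's GEN 10 beyond-window DATA record in `X11b/BeyondWindowRecords44.lean` (Skinner 2016 Thm. A ∘ Stein–Wuthrich 2013
`p`-adic road, binders as displayed there) — this row is a SECOND road). `D = -1871` (1871 prime): **`m = [E(K):ℤy_K] = 72`, `5 ∤ m`**
(`ρ = 1295.99…`; `L'(E,1) = 8.82202729…`, `L(E^D,1) = 1.53646134…`, `ĥ(x) = 0.97948334…`) — engine 1 (j259809) = engine 2 (j260666; EQUAL, dev. ≤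
3.9·10⁻¹⁵, checks true); twist `E^D` (j260667): `#tors·∏c·#Ш_an = 1·24·9`, prime to `5` — BSD-consistent. Witnesses mod `5` `(ℓ,#Ẽ(𝔽_ℓ))` =
`(17,11)` (`a = 7`, `a² − 4ℓ ≡ 1` square), `(7,9)` (`a = -1`, `a² − 4ℓ ≡ 3` non-square), `(7,9)` (`u ≡ 3`).
[cite: McCallumLMS1991, §1 Theorem (Kolyvagin), p. 296] [cite: Serre1972, §2.8 Prop. 19] [cite: Cremona2006, Table 1 (label 349680bh1)] -/
theorem bsdp_k349680bh1_5 (hGZK : rank_eq_analyticRank_of_analyticRank_le_one) (W : WeierstrassCurve ℚ)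
    (hW : W = ⟨0, 1, 0, -3216, 102420⟩) {N : ℕ} [NeZero N] {K : Type} [Field K] [NumberField K]
    (hKo : kolyvagin N W K) (hB : Kolyvagin1990_padicValNat_card_sha_le N W K) (hK : IsImaginaryQuadratic K)
    (hH : SatisfiesHeegnerHypothesis N K) {P : (W.baseChange K).toAffine.Point} (hP : IsHeegnerPoint N W K P)
    (hnt : ¬ IsOfFinAddOrder P) (hI : ¬ 5 ∣ (AddSubgroup.zmultiples P).index) (hr : W.analyticRank ≤ 1)
    {q : ℚ} (hq : shaAn W = (q : ℂ)) (hv : padicValRat 5 q = 0) : BSDp W 5 :=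
  bsdp_prime_of_kolyvaginIndex_of_serreCounts_support 5 (by norm_num) (by norm_num) 0 1 0 (-3216) 102420 (by decide +kernel)
    [(2, 4, 14), (3, 1, 3), (5, 1, 3), (31, 1, 2), (47, 1, 1)] (by intro t ht; fin_cases ht <;> norm_num) (by decide +kernel)
    (by decide +kernel) 17 7 7 (by norm_num) (by norm_num) (by norm_num) (by norm_num)
    (by norm_num) (by norm_num) (by norm_num) (by norm_num) (by norm_num) (by decide +kernel) (by decide +kernel)
    (by decide +kernel) (n₁ := 11) (n₂ := 9) (n₃ := 9) (hc₁ := by decide +kernel) (hc₂ := by decide +kernel)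
    (hc₃ := by decide +kernel) (by decide +kernel) (by decide +kernel) (by decide +kernel) hGZK W
    (by rw [hW]; norm_num) hKo hB hK hH hP hnt hI hr hq hv

/-- **`BSD(E,5)` for `349690cw1`** (`N = 349690 = 2·5·11²·17²`; SPLIT MULTIPLICATIVE at `5` (Kodaira `I1`, `c_5 = 1`, additive at `11`, `17`);
`#tors = 1`, `∏c = 2`, `r_an = 1`, `#Ш_an = 1`, generator Cremona's (23-digit numerator); lane residue cell `(5, X11b)` (bsdN v4u/v5u of record:
`residue:X11b`, lane tail T-KOLY); ALSO the unit's GEN 10 beyond-window DATA record in `X11b/BeyondWindowRecords44.lean` (Skinner 2016 Thm. A ∘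
Stein–Wuthrich 2013 `p`-adic road, binders as displayed there) — this row is a SECOND road). `D = -591` (591 = 3·197): **`m = [E(K):ℤy_K] = 84`,
`5 ∤ m`** (`ρ = 1764.00…`; `L'(E,1) = 19.40478522…`, `L(E^D,1) = 11.42088373…`, `ĥ(x) = 50.26380755…`) — engine 1 (j259809) = engine 2 (j260666;
EQUAL, dev. ≤ 8.7·10⁻¹⁵, checks true); twist `E^D` (j260667): `#tors·∏c·#Ш_an = 1·4·441`, prime to `5` — BSD-consistent. Witnesses mod `5`
`(ℓ,#Ẽ(𝔽_ℓ))` = `(13,18)` (`a = -4`, `a² − 4ℓ ≡ 4` square), `(3,1)` (`a = 3`, `a² − 4ℓ ≡ 2` non-square), `(3,1)` (`u ≡ 3`).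
[cite: McCallumLMS1991, §1 Theorem (Kolyvagin), p. 296] [cite: Serre1972, §2.8 Prop. 19] [cite: Cremona2006, Table 1 (label 349690cw1)] -/
theorem bsdp_k349690cw1_5 (hGZK : rank_eq_analyticRank_of_analyticRank_le_one) (W : WeierstrassCurve ℚ)
    (hW : W = ⟨1, -1, 1, 168288, 24684289⟩) {N : ℕ} [NeZero N] {K : Type} [Field K] [NumberField K]
    (hKo : kolyvagin N W K) (hB : Kolyvagin1990_padicValNat_card_sha_le N W K) (hK : IsImaginaryQuadratic K)
    (hH : SatisfiesHeegnerHypothesis N K) {P : (W.baseChange K).toAffine.Point} (hP : IsHeegnerPoint N W K P)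
    (hnt : ¬ IsOfFinAddOrder P) (hI : ¬ 5 ∣ (AddSubgroup.zmultiples P).index) (hr : W.analyticRank ≤ 1)
    {q : ℚ} (hq : shaAn W = (q : ℂ)) (hv : padicValRat 5 q = 0) : BSDp W 5 :=
  bsdp_prime_of_kolyvaginIndex_of_serreCounts 5 (by norm_num) (by norm_num) 1 (-1) 1 168288 24684289 (by decide +kernel)
    (by decide +kernel) (by decide +kernel) 13 3 3 (by norm_num) (by norm_num) (by norm_num) (by norm_num)
    (by norm_num) (by norm_num) (by norm_num) (by norm_num) (by norm_num) (by decide +kernel) (by decide +kernel)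
    (by decide +kernel) (n₁ := 18) (n₂ := 1) (n₃ := 1) (hc₁ := by decide +kernel) (hc₂ := by decide +kernel)
    (hc₃ := by decide +kernel) (by decide +kernel) (by decide +kernel) (by decide +kernel) hGZK W
    (by rw [hW]; norm_num) hKo hB hK hH hP hnt hI hr hq hv

/-- **`BSD(E,5)` for `350610bo1`** (`N = 350610 = 2·3·5·13·29·31`; NON-SPLIT MULTIPLICATIVE at `5` (Kodaira `I7`, `c_5 = 1`, semistable); `#tors = 1`,
`∏c = 3`, `r_an = 1`, `#Ш_an = 1`, generator `(456079/6724, 246567205/551368)`; lane residue cell `(5, X11b)` (bsdN v4u/v5u of record: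
`residue:X11b`, lane tail T-KOLY); ALSO the unit's GEN 10 beyond-window DATA record in `X11b/BeyondWindowRecords44.lean` (Skinner 2016 Thm. A ∘
Stein–Wuthrich 2013 `p`-adic road, binders as displayed there) — this row is a SECOND road). `D = -2471` (2471 = 7·353): **`m = [E(K):ℤy_K] = 36`,
`5 ∤ m`** (`ρ = 324.00…`; `L'(E,1) = 15.73293038…`, `L(E^D,1) = 4.57322548…`, `ĥ(x) = 12.54841110…`) — engine 1 (j259809) = engine 2 (j260666;
EQUAL, dev. ≤ 7.6·10⁻¹⁴, checks true); twist `E^D` (j260667): `#tors·∏c·#Ш_an = 1·24·9`, prime to `5` — BSD-consistent. Witnesses mod `5`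
`(ℓ,#Ẽ(𝔽_ℓ))` = `(7,10)` (`a = -2`, `a² − 4ℓ ≡ 1` square), `(11,8)` (`a = 4`, `a² − 4ℓ ≡ 2` non-square), `(17,17)` (`u ≡ 3`).
[cite: McCallumLMS1991, §1 Theorem (Kolyvagin), p. 296] [cite: Serre1972, §2.8 Prop. 19] [cite: Cremona2006, Table 1 (label 350610bo1)] -/
theorem bsdp_k350610bo1_5 (hGZK : rank_eq_analyticRank_of_analyticRank_le_one) (W : WeierstrassCurve ℚ)
    (hW : W = ⟨1, 0, 0, -971, -15885⟩) {N : ℕ} [NeZero N] {K : Type} [Field K] [NumberField K]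
    (hKo : kolyvagin N W K) (hB : Kolyvagin1990_padicValNat_card_sha_le N W K) (hK : IsImaginaryQuadratic K)
    (hH : SatisfiesHeegnerHypothesis N K) {P : (W.baseChange K).toAffine.Point} (hP : IsHeegnerPoint N W K P)
    (hnt : ¬ IsOfFinAddOrder P) (hI : ¬ 5 ∣ (AddSubgroup.zmultiples P).index) (hr : W.analyticRank ≤ 1)
    {q : ℚ} (hq : shaAn W = (q : ℂ)) (hv : padicValRat 5 q = 0) : BSDp W 5 :=
  bsdp_prime_of_kolyvaginIndex_of_serreCounts 5 (by norm_num) (by norm_num) 1 0 0 (-971) (-15885) (by decide +kernel)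
    (by decide +kernel) (by decide +kernel) 7 11 17 (by norm_num) (by norm_num) (by norm_num) (by norm_num)
    (by norm_num) (by norm_num) (by norm_num) (by norm_num) (by norm_num) (by decide +kernel) (by decide +kernel)
    (by decide +kernel) (n₁ := 10) (n₂ := 8) (n₃ := 17) (hc₁ := by decide +kernel) (hc₂ := by decide +kernel)
    (hc₃ := by decide +kernel) (by decide +kernel) (by decide +kernel) (by decide +kernel) hGZK W
    (by rw [hW]; norm_num) hKo hB hK hH hP hnt hI hr hq hv

/-- **`BSD(E,5)` for `350610f1`** (`N = 350610 = 2·3·5·13·29·31`; NON-SPLIT MULTIPLICATIVE at `5` (Kodaira `I5`, `c_5 = 1`, semistable); `#tors = 2`,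
`∏c = 8`, `r_an = 1`, `#Ш_an = 1`, generator `(-133/4, 23681/8)`; lane residue cell `(5, X11b)` (bsdN v4u/v5u of record: `residue:X11b`, lane tail
T-KOLY); ALSO the unit's GEN 10 beyond-window DATA record in `X11b/BeyondWindowRecords44.lean` (Skinner 2016 Thm. A ∘ Stein–Wuthrich 2013 `p`-adic
road, binders as displayed there) — this row is a SECOND road). `D = -2471` (2471 = 7·353): **`m = [E(K):ℤy_K] = 8`, `5 ∤ m`** (`ρ = 15.99…`;
`L'(E,1) = 3.33436485…`, `L(E^D,1) = 0.04387463…`, `ĥ(x) = 5.63067506…`) — engine 1 (j259809) = engine 2 (j260666; EQUAL, dev. ≤ 1.7·10⁻¹³, checks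
true); twist `E^D` (j260667): `#tors·∏c·#Ш_an = 2·32·1`, prime to `5` — BSD-consistent. Witnesses mod `5` `(ℓ,#Ẽ(𝔽_ℓ))` = `(7,6)` (`a = 2`,
`a² − 4ℓ ≡ 1` square), `(17,22)` (`a = -4`, `a² − 4ℓ ≡ 3` non-square), `(17,22)` (`u ≡ 3`).
[cite: McCallumLMS1991, §1 Theorem (Kolyvagin), p. 296] [cite: Serre1972, §2.8 Prop. 19] [cite: Cremona2006, Table 1 (label 350610f1)] -/
theorem bsdp_k350610f1_5 (hGZK : rank_eq_analyticRank_of_analyticRank_le_one) (W : WeierstrassCurve ℚ)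
    (hW : W = ⟨1, 1, 0, -118833, 4748373⟩) {N : ℕ} [NeZero N] {K : Type} [Field K] [NumberField K]
    (hKo : kolyvagin N W K) (hB : Kolyvagin1990_padicValNat_card_sha_le N W K) (hK : IsImaginaryQuadratic K)
    (hH : SatisfiesHeegnerHypothesis N K) {P : (W.baseChange K).toAffine.Point} (hP : IsHeegnerPoint N W K P)
    (hnt : ¬ IsOfFinAddOrder P) (hI : ¬ 5 ∣ (AddSubgroup.zmultiples P).index) (hr : W.analyticRank ≤ 1)
    {q : ℚ} (hq : shaAn W = (q : ℂ)) (hv : padicValRat 5 q = 0) : BSDp W 5 :=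
  bsdp_prime_of_kolyvaginIndex_of_serreCounts 5 (by norm_num) (by norm_num) 1 1 0 (-118833) 4748373 (by decide +kernel)
    (by decide +kernel) (by decide +kernel) 7 17 17 (by norm_num) (by norm_num) (by norm_num) (by norm_num)
    (by norm_num) (by norm_num) (by norm_num) (by norm_num) (by norm_num) (by decide +kernel) (by decide +kernel)
    (by decide +kernel) (n₁ := 6) (n₂ := 22) (n₃ := 22) (hc₁ := by decide +kernel) (hc₂ := by decide +kernel)
    (hc₃ := by decide +kernel) (by decide +kernel) (by decide +kernel) (by decide +kernel) hGZK W
    (by rw [hW]; norm_num) hKo hB hK hH hP hnt hI hr hq hv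

/-- **`BSD(E,5)` for `351030c1`** (`N = 351030 = 2·3·5·11701`; NON-SPLIT MULTIPLICATIVE at `5` (Kodaira `I1`, `c_5 = 1`, semistable); `#tors = 1`,
`∏c = 1`, `r_an = 1`, `#Ш_an = 1`, generator `(-13771/2704, 459317/140608)`; lane residue cell `(5, X11b)` (bsdN v4u/v5u of record: `residue:X11b`,
lane tail T-KOLY); ALSO the unit's GEN 10 beyond-window DATA record in `X11b/BeyondWindowRecords44.lean` (Skinner 2016 Thm. A ∘ Stein–Wuthrich 2013
`p`-adic road, binders as displayed there) — this row is a SECOND road). `D = -959` (959 = 7·137): **`m = [E(K):ℤy_K] = 16`, `5 ∤ m`**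
(`ρ = 63.99…`; `L'(E,1) = 15.23733430…`, `L(E^D,1) = 6.28805919…`, `ĥ(x) = 9.09159846…`) — engine 1 (j259809) = engine 2 (j260660; EQUAL, dev. ≤
4.8·10⁻¹⁴, checks true); twist `E^D` (j260667): `#tors·∏c·#Ш_an = 1·4·16`, prime to `5` — BSD-consistent. Witnesses mod `5` `(ℓ,#Ẽ(𝔽_ℓ))` =
`(17,16)` (`a = 2`, `a² − 4ℓ ≡ 1` square), `(23,17)` (`a = 7`, `a² − 4ℓ ≡ 2` non-square), `(23,17)` (`u ≡ 3`).
[cite: McCallumLMS1991, §1 Theorem (Kolyvagin), p. 296] [cite: Serre1972, §2.8 Prop. 19] [cite: Cremona2006, Table 1 (label 351030c1)] -/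
theorem bsdp_k351030c1_5 (hGZK : rank_eq_analyticRank_of_analyticRank_le_one) (W : WeierstrassCurve ℚ)
    (hW : W = ⟨1, 0, 0, -66, -210⟩) {N : ℕ} [NeZero N] {K : Type} [Field K] [NumberField K]
    (hKo : kolyvagin N W K) (hB : Kolyvagin1990_padicValNat_card_sha_le N W K) (hK : IsImaginaryQuadratic K)
    (hH : SatisfiesHeegnerHypothesis N K) {P : (W.baseChange K).toAffine.Point} (hP : IsHeegnerPoint N W K P)
    (hnt : ¬ IsOfFinAddOrder P) (hI : ¬ 5 ∣ (AddSubgroup.zmultiples P).index) (hr : W.analyticRank ≤ 1)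
    {q : ℚ} (hq : shaAn W = (q : ℂ)) (hv : padicValRat 5 q = 0) : BSDp W 5 :=
  bsdp_prime_of_kolyvaginIndex_of_serreCounts 5 (by norm_num) (by norm_num) 1 0 0 (-66) (-210) (by decide +kernel)
    (by decide +kernel) (by decide +kernel) 17 23 23 (by norm_num) (by norm_num) (by norm_num) (by norm_num)
    (by norm_num) (by norm_num) (by norm_num) (by norm_num) (by norm_num) (by decide +kernel) (by decide +kernel)
    (by decide +kernel) (n₁ := 16) (n₂ := 17) (n₃ := 17) (hc₁ := by decide +kernel) (hc₂ := by decide +kernel)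
    (hc₃ := by decide +kernel) (by decide +kernel) (by decide +kernel) (by decide +kernel) hGZK W
    (by rw [hW]; norm_num) hKo hB hK hH hP hnt hI hr hq hv

/-- **`BSD(E,5)` for `351120bq1`** (`N = 351120 = 2⁴·3·5·7·11·19`; NON-SPLIT MULTIPLICATIVE at `5` (Kodaira `I9`, `c_5 = 1`, additive at `2`);
`#tors = 1`, `∏c = 2`, `r_an = 1`, `#Ш_an = 1`, generator `(-3988/49, 7947897/343)`; lane residue cell `(5, X11b)` (bsdN v4u/v5u of record:
`residue:X11b`, lane tail T-KOLY); ALSO the unit's GEN 10 beyond-window DATA record in `X11b/BeyondWindowRecords44.lean` (Skinner 2016 Thm. A ∘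
Stein–Wuthrich 2013 `p`-adic road, binders as displayed there) — this row is a SECOND road). `D = -2351` (2351 prime): **`m = [E(K):ℤy_K] = 28`,
`5 ∤ m`** (`ρ = 196.00…`; `L'(E,1) = 5.52827974…`, `L(E^D,1) = 0.29781625…`, `ĥ(x) = 10.27415366…`) — engine 1 (j259809) = engine 2 (j260660; EQUAL,
dev. ≤ 1.9·10⁻¹³, checks true); twist `E^D` (j260667): `#tors·∏c·#Ш_an = 1·4·49`, prime to `5` — BSD-consistent. Witnesses mod `5` `(ℓ,#Ẽ(𝔽_ℓ))` =
`(23,30)` (`a = -6`, `a² − 4ℓ ≡ 4` square), `(31,43)` (`a = -11`, `a² − 4ℓ ≡ 2` non-square), `(53,47)` (`u ≡ 3`).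
[cite: McCallumLMS1991, §1 Theorem (Kolyvagin), p. 296] [cite: Serre1972, §2.8 Prop. 19] [cite: Cremona2006, Table 1 (label 351120bq1)] -/
theorem bsdp_k351120bq1_5 (hGZK : rank_eq_analyticRank_of_analyticRank_le_one) (W : WeierstrassCurve ℚ)
    (hW : W = ⟨0, -1, 0, -1099301, 448004301⟩) {N : ℕ} [NeZero N] {K : Type} [Field K] [NumberField K]
    (hKo : kolyvagin N W K) (hB : Kolyvagin1990_padicValNat_card_sha_le N W K) (hK : IsImaginaryQuadratic K)
    (hH : SatisfiesHeegnerHypothesis N K) {P : (W.baseChange K).toAffine.Point} (hP : IsHeegnerPoint N W K P)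
    (hnt : ¬ IsOfFinAddOrder P) (hI : ¬ 5 ∣ (AddSubgroup.zmultiples P).index) (hr : W.analyticRank ≤ 1)
    {q : ℚ} (hq : shaAn W = (q : ℂ)) (hv : padicValRat 5 q = 0) : BSDp W 5 :=
  bsdp_prime_of_kolyvaginIndex_of_serreCounts 5 (by norm_num) (by norm_num) 0 (-1) 0 (-1099301) 448004301 (by decide +kernel)
    (by decide +kernel) (by decide +kernel) 23 31 53 (by norm_num) (by norm_num) (by norm_num) (by norm_num)
    (by norm_num) (by norm_num) (by norm_num) (by norm_num) (by norm_num) (by decide +kernel) (by decide +kernel)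
    (by decide +kernel) (n₁ := 30) (n₂ := 43) (n₃ := 47) (hc₁ := by decide +kernel) (hc₂ := by decide +kernel)
    (hc₃ := by decide +kernel) (by decide +kernel) (by decide +kernel) (by decide +kernel) hGZK W
    (by rw [hW]; norm_num) hKo hB hK hH hP hnt hI hr hq hv

/-- **`BSD(E,5)` for `351120cr1`** (`N = 351120 = 2⁴·3·5·7·11·19`; SPLIT MULTIPLICATIVE at `5` (Kodaira `I11`, `c_5 = 11`, additive at `2`);
`#tors = 1`, `∏c = 22`, `r_an = 1`, `#Ш_an = 1`, generator `(-126, 6250)`; lane residue cell `(5, X11b)` (bsdN v4u/v5u of record: `residue:X11b`,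
lane tail T-KOLY); ALSO the unit's GEN 10 beyond-window DATA record in `X11b/BeyondWindowRecords44.lean` (Skinner 2016 Thm. A ∘ Stein–Wuthrich 2013
`p`-adic road, binders as displayed there) — this row is a SECOND road). `D = -3071` (3071 = 37·83): **`m = [E(K):ℤy_K] = 132`, `5 ∤ m`**
(`ρ = 4356.00…`; `L'(E,1) = 5.16118460…`, `L(E^D,1) = 0.87330646…`, `ĥ(x) = 1.61917222…`) — engine 1 (j259809) = engine 2 (j260660; EQUAL, dev. ≤
1.0·10⁻¹³, checks true); twist `E^D` (j260667): `#tors·∏c·#Ш_an = 1·44·9`, prime to `5` — BSD-consistent. Witnesses mod `5` `(ℓ,#Ẽ(𝔽_ℓ))` =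
`(17,15)` (`a = 3`, `a² − 4ℓ ≡ 1` square), `(13,21)` (`a = -7`, `a² − 4ℓ ≡ 2` non-square), `(13,21)` (`u ≡ 3`).
[cite: McCallumLMS1991, §1 Theorem (Kolyvagin), p. 296] [cite: Serre1972, §2.8 Prop. 19] [cite: Cremona2006, Table 1 (label 351120cr1)] -/
theorem bsdp_k351120cr1_5 (hGZK : rank_eq_analyticRank_of_analyticRank_le_one) (W : WeierstrassCurve ℚ)
    (hW : W = ⟨0, -1, 0, 527120, 107495872⟩) {N : ℕ} [NeZero N] {K : Type} [Field K] [NumberField K]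
    (hKo : kolyvagin N W K) (hB : Kolyvagin1990_padicValNat_card_sha_le N W K) (hK : IsImaginaryQuadratic K)
    (hH : SatisfiesHeegnerHypothesis N K) {P : (W.baseChange K).toAffine.Point} (hP : IsHeegnerPoint N W K P)
    (hnt : ¬ IsOfFinAddOrder P) (hI : ¬ 5 ∣ (AddSubgroup.zmultiples P).index) (hr : W.analyticRank ≤ 1)
    {q : ℚ} (hq : shaAn W = (q : ℂ)) (hv : padicValRat 5 q = 0) : BSDp W 5 :=
  bsdp_prime_of_kolyvaginIndex_of_serreCounts_support 5 (by norm_num) (by norm_num) 0 (-1) 0 527120 107495872 (by decide +kernel)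
    [(2, 4, 26), (3, 1, 1), (5, 1, 11), (7, 1, 1), (11, 1, 1), (19, 1, 1)] (by intro t ht; fin_cases ht <;> norm_num) (by decide +kernel)
    (by decide +kernel) 17 13 13 (by norm_num) (by norm_num) (by norm_num) (by norm_num)
    (by norm_num) (by norm_num) (by norm_num) (by norm_num) (by norm_num) (by decide +kernel) (by decide +kernel)
    (by decide +kernel) (n₁ := 15) (n₂ := 21) (n₃ := 21) (hc₁ := by decide +kernel) (hc₂ := by decide +kernel)
    (hc₃ := by decide +kernel) (by decide +kernel) (by decide +kernel) (by decide +kernel) hGZK W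
    (by rw [hW]; norm_num) hKo hB hK hH hP hnt hI hr hq hv

/-- **`BSD(E,5)` for `351120dd1`** (`N = 351120 = 2⁴·3·5·7·11·19`; SPLIT MULTIPLICATIVE at `5` (Kodaira `I1`, `c_5 = 1`, additive at `2`); `#tors = 1`,
`∏c = 6`, `r_an = 1`, `#Ш_an = 1`, generator `(52, 21)`; lane residue cell `(5, X11b)` (bsdN v4u/v5u of record: `residue:X11b`, lane tail T-KOLY);
ALSO the unit's GEN 10 beyond-window DATA record in `X11b/BeyondWindowRecords45.lean` (Skinner 2016 Thm. A ∘ Stein–Wuthrich 2013 `p`-adic road,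
binders as displayed there) — this row is a SECOND road). `D = -2351` (2351 prime): **`m = [E(K):ℤy_K] = 36`, `5 ∤ m`** (`ρ = 324.00…`;
`L'(E,1) = 7.11010779…`, `L(E^D,1) = 0.57085822…`, `ĥ(x) = 0.96278499…`) — engine 1 (j259809) = engine 2 (j260660; EQUAL, dev. ≤ 1.9·10⁻¹³, checks
true); twist `E^D` (j260667): `#tors·∏c·#Ш_an = 1·12·9`, prime to `5` — BSD-consistent. Witnesses mod `5` `(ℓ,#Ẽ(𝔽_ℓ))` = `(13,15)` (`a = -1`,
`a² − 4ℓ ≡ 4` square), `(47,57)` (`a = -9`, `a² − 4ℓ ≡ 3` non-square), `(47,57)` (`u ≡ 3`).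
[cite: McCallumLMS1991, §1 Theorem (Kolyvagin), p. 296] [cite: Serre1972, §2.8 Prop. 19] [cite: Cremona2006, Table 1 (label 351120dd1)] -/
theorem bsdp_k351120dd1_5 (hGZK : rank_eq_analyticRank_of_analyticRank_le_one) (W : WeierstrassCurve ℚ)
    (hW : W = ⟨0, -1, 0, -7525, 253837⟩) {N : ℕ} [NeZero N] {K : Type} [Field K] [NumberField K]
    (hKo : kolyvagin N W K) (hB : Kolyvagin1990_padicValNat_card_sha_le N W K) (hK : IsImaginaryQuadratic K)
    (hH : SatisfiesHeegnerHypothesis N K) {P : (W.baseChange K).toAffine.Point} (hP : IsHeegnerPoint N W K P)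
    (hnt : ¬ IsOfFinAddOrder P) (hI : ¬ 5 ∣ (AddSubgroup.zmultiples P).index) (hr : W.analyticRank ≤ 1)
    {q : ℚ} (hq : shaAn W = (q : ℂ)) (hv : padicValRat 5 q = 0) : BSDp W 5 :=
  bsdp_prime_of_kolyvaginIndex_of_serreCounts 5 (by norm_num) (by norm_num) 0 (-1) 0 (-7525) 253837 (by decide +kernel)
    (by decide +kernel) (by decide +kernel) 13 47 47 (by norm_num) (by norm_num) (by norm_num) (by norm_num)
    (by norm_num) (by norm_num) (by norm_num) (by norm_num) (by norm_num) (by decide +kernel) (by decide +kernel)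
    (by decide +kernel) (n₁ := 15) (n₂ := 57) (n₃ := 57) (hc₁ := by decide +kernel) (hc₂ := by decide +kernel)
    (hc₃ := by decide +kernel) (by decide +kernel) (by decide +kernel) (by decide +kernel) hGZK W
    (by rw [hW]; norm_num) hKo hB hK hH hP hnt hI hr hq hv

end Summit.BirchSwinnertonDyer.Rank1Residual.X11b

end
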